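import HarnessLib
import Literature.Probability.LatticeModels.PointwiseScalingLimitScaleCovariant
import Literature.Probability.LatticeModels.PointwiseScalingLimitTwoPointMono

/-!
# Vague asymptotic isotropy of the critical `ℤ³` two-point function, XV:
# scale covariance and regular variation from POINTWISE convergence of the pair correlator
(route HarmonicMomentsIsotropy, support item stmt-CriticalPhenomena-6036 `TwoPointAsymptoticIsotropy`;
first file of the pointwise line: item stmt-CriticalPhenomena-6153 `PointwiseLimit` ⇒ item 6036)

Pointwise forms of file XII (`…PairScale`): the hypothesis is only the POINTWISE convergence of the
renormalised critical pair correlator at every non-coincident pair,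
`∀ z ∈ NonCoincident 3 2, Tendsto (fun δ => rescaledCorrelator (criticalCorr 3) ρ 2 δ z) (𝓝[>] 0) (𝓝 (S₂ z))`
(`ρ > 0` on `(0,1]`, `S₂ > 0` on non-coincident pairs); every proof of file XII used the locally uniform
convergence only through its pointwise values, so the same arguments give: `tendsto_comp_smul_pt`
(self-similarity), `exists_scale_pt` (uniqueness up to one scale), `two_le_two_of_mul_norm_lt_pt` (MMS in
the limit), `pair_scale_identity_pt` and `exists_rpow_scale_and_ratio_pt`: **there is `Δ ≥ 0` with
`S₂(c·x) = c^{-2Δ} S₂(x)` on non-coincident pairs and `ρ(cδ)/ρ(δ) → c^{-Δ}` for every `c > 0`.** The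
homogeneity is the input of the continuity of the pointwise limit kernel (file XVII), from which locally
uniform convergence follows (file XVIII, a Pólya–Dini argument on Messager–Miracle-Solé monotone
functions).

References: A. Messager, S. Miracle-Solé, J. Stat. Phys. 17 (1977) 245–262 [MessagerMiracleSoleJSP1977];
P. Di Francesco, P. Mathieu, D. Sénéchal, *Conformal Field Theory* (1997), §4.3.1
[FrancescoMathieuSenechal1997]. No definitions are introduced.
-/

noncomputable section

namespace Summit.CriticalPhenomena.Ising3DConformalLimit.HarmonicMomentsIsotropyTwoPoint

open Literature.Probability.LatticeModels Filter Set
open scoped Topology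

/-! ### Self-similarity, pointwise -/

/-- **Self-similarity of pointwise pair limits** (any lattice family `G` on `ℤ³`): if the rescaled pair
correlator converges at every non-coincident pair with renormalisation `ρ`, then for `c > 0` the one with
renormalisation `δ ↦ ρ(cδ)` converges at `z` to `S₂(c·z)`. [folklore] -/
theorem tendsto_comp_smul_pt {G : LatticeCorrFamily 3} {ρ : ℝ → ℝ}
    {S2 : (Fin 2 → EuclideanSpace ℝ (Fin 3)) → ℝ}
    (h : ∀ z ∈ NonCoincident 3 2, Tendsto (fun δ => rescaledCorrelator G ρ 2 δ z) (𝓝[>] (0:ℝ))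
      (𝓝 (S2 z)))
    {c : ℝ} (hc : 0 < c) :
    ∀ z ∈ NonCoincident 3 2, Tendsto (fun δ => rescaledCorrelator G (fun δ => ρ (c * δ)) 2 δ z)
      (𝓝[>] (0:ℝ)) (𝓝 (S2 (fun i => c • z i))) := by
  intro z hz
  have hmul : Tendsto (fun δ : ℝ => c * δ) (𝓝[>] 0) (𝓝[>] 0) := by
    refine tendsto_nhdsWithin_iff.2 ⟨?_, eventually_mem_nhdsWithin.mono fun δ hδ => mul_pos hc hδ⟩
    have h0 : Tendsto (fun δ : ℝ => c * δ) (𝓝 0) (𝓝 (c * 0)) := tendsto_id.const_mul c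
    rw [mul_zero] at h0
    exact h0.mono_left nhdsWithin_le_nhds
  have h1 := (h _ (smul_mem_nonCoincident hc.ne' hz)).comp hmul
  refine h1.congr fun δ => ?_
  simp only [Function.comp_apply]
  rw [rescaledCorrelator_comp_smul G ρ hc.ne']

/-! ### Uniqueness of the pair limit up to one scale -/

/-- **Two pointwise pair limits of the same lattice family differ by one positive constant.** If `S₂`
(renormalisation `ρ > 0` on `(0,1]`) and `S₂'` (renormalisation `ρ' > 0` on `(0,1]`) are limits of the
rescaled pair correlator of the same `G`, both positive at one non-coincident pair `x₀`, then
`ρ'/ρ → c := (S₂' x₀ / S₂ x₀)^{1/2} > 0` and `S₂' = c² S₂` on non-coincident pairs. [folklore] -/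
theorem exists_scale_pt {G : LatticeCorrFamily 3} {ρ ρ' : ℝ → ℝ}
    {S2 S2' : (Fin 2 → EuclideanSpace ℝ (Fin 3)) → ℝ}
    (hρ : ∀ δ ∈ Set.Ioc (0:ℝ) 1, 0 < ρ δ) (hρ' : ∀ δ ∈ Set.Ioc (0:ℝ) 1, 0 < ρ' δ)
    (hlim : ∀ z ∈ NonCoincident 3 2, Tendsto (fun δ => rescaledCorrelator G ρ 2 δ z) (𝓝[>] (0:ℝ))
      (𝓝 (S2 z)))
    (hlim' : ∀ z ∈ NonCoincident 3 2, Tendsto (fun δ => rescaledCorrelator G ρ' 2 δ z) (𝓝[>] (0:ℝ))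
      (𝓝 (S2' z)))
    {x₀ : Fin 2 → EuclideanSpace ℝ (Fin 3)} (hx₀ : x₀ ∈ NonCoincident 3 2) (ha0 : 0 < S2 x₀)
    (hb0 : 0 < S2' x₀) :
    ∃ c : ℝ, 0 < c ∧ (∀ x ∈ NonCoincident 3 2, S2' x = c ^ 2 * S2 x) ∧
      Tendsto (fun δ => ρ' δ / ρ δ) (𝓝[>] 0) (𝓝 c) := by
  set g : ℝ → ℝ := fun δ => G 2 (fun i => latticeApprox δ (x₀ i)) with hg
  have ha : Tendsto (fun δ => ρ δ ^ 2 * g δ) (𝓝[>] 0) (𝓝 (S2 x₀)) := hlim x₀ hx₀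
  have hb : Tendsto (fun δ => ρ' δ ^ 2 * g δ) (𝓝[>] 0) (𝓝 (S2' x₀)) := hlim' x₀ hx₀
  have hIoc : Set.Ioc (0:ℝ) 1 ∈ 𝓝[>] (0:ℝ) := Ioc_mem_nhdsGT one_pos
  have hev : ∀ᶠ δ in 𝓝[>] (0:ℝ), δ ∈ Set.Ioc (0:ℝ) 1 ∧ 0 < ρ δ ^ 2 * g δ :=
    (Filter.eventually_of_mem hIoc fun δ hδ => hδ).and (ha.eventually_const_lt ha0)
  have hr2 : Tendsto (fun δ => (ρ' δ / ρ δ) ^ 2) (𝓝[>] 0) (𝓝 (S2' x₀ / S2 x₀)) := by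
    have hq : Tendsto (fun δ => (ρ' δ ^ 2 * g δ) / (ρ δ ^ 2 * g δ)) (𝓝[>] 0)
        (𝓝 (S2' x₀ / S2 x₀)) := hb.div ha ha0.ne'
    refine hq.congr' ?_
    filter_upwards [hev] with δ hδ
    have hg0 : g δ ≠ 0 := by
      intro h0; rw [h0, mul_zero] at hδ; exact lt_irrefl _ hδ.2
    rw [div_pow, mul_div_mul_right _ _ hg0]
  set c : ℝ := Real.sqrt (S2' x₀ / S2 x₀) with hc
  have hcpos : 0 < c := Real.sqrt_pos.2 (div_pos hb0 ha0)
  have hr : Tendsto (fun δ => ρ' δ / ρ δ) (𝓝[>] 0) (𝓝 c) := by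
    refine hr2.sqrt.congr' ?_
    filter_upwards [hev] with δ hδ
    exact Real.sqrt_sq (div_pos (hρ' δ hδ.1) (hρ δ hδ.1)).le
  refine ⟨c, hcpos, fun x hx => ?_, hr⟩
  have h1 : Tendsto (fun δ => ρ' δ ^ 2 * G 2 (fun i => latticeApprox δ (x i)))
      (𝓝[>] 0) (𝓝 (S2' x)) := hlim' x hx
  have h2 : Tendsto (fun δ => (ρ' δ / ρ δ) ^ 2 * (ρ δ ^ 2 * G 2 (fun i => latticeApprox δ (x i))))
      (𝓝[>] 0) (𝓝 (c ^ 2 * S2 x)) := (hr.pow 2).mul (hlim x hx)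
  refine tendsto_nhds_unique h1 (h2.congr' ?_)
  filter_upwards [hev] with δ hδ
  have hρ0 : ρ δ ≠ 0 := (hρ δ hδ.1).ne'
  rw [div_pow, ← mul_assoc, div_mul_cancel₀ _ (pow_ne_zero 2 hρ0)]

/-! ### Messager–Miracle-Solé monotonicity in the pair limit -/

variable {ρ : ℝ → ℝ} {S2 : (Fin 2 → EuclideanSpace ℝ (Fin 3)) → ℝ}

/-- **Inward quasi-monotonicity of a pointwise pair limit** (MMS comparison `twoPointPlus_le_of_mul_supNorm_le` in
the limit): `S₂(x') ≤ S₂(x)` for non-coincident pairs with `3‖x₀ − x₁‖_∞ < ‖x'₀ − x'₁‖_∞`.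
[cite: MessagerMiracleSoleJSP1977, Theorem (monotonicity)] -/
theorem two_le_two_of_mul_norm_lt_pt
    (hlim2 : ∀ z ∈ NonCoincident 3 2, Tendsto (fun δ => rescaledCorrelator (criticalCorr 3) ρ 2 δ z)
      (𝓝[>] (0:ℝ)) (𝓝 (S2 z)))
    {x x' : Fin 2 → EuclideanSpace ℝ (Fin 3)} (hx : x ∈ NonCoincident 3 2)
    (hx' : x' ∈ NonCoincident 3 2)
    (hfar : (3 : ℝ) * ‖WithLp.ofLp (x 0) - WithLp.ofLp (x 1)‖ <
      ‖WithLp.ofLp (x' 0) - WithLp.ofLp (x' 1)‖) :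
    S2 x' ≤ S2 x := by
  have hβ : 0 ≤ criticalBeta 3 := criticalBeta_nonneg 3
  -- the two rescaled pair correlators
  have hT : ∀ {z : Fin 2 → EuclideanSpace ℝ (Fin 3)}, z ∈ NonCoincident 3 2 →
      Tendsto (fun δ => ρ δ ^ 2 * criticalTwoPoint 3 (latticeApprox δ (z 1) - latticeApprox δ (z 0)))
        (𝓝[>] 0) (𝓝 (S2 z)) := by
    intro z hz
    refine Tendsto.congr (fun δ => ?_) (hlim2 _ hz)
    rw [rescaledCorrelator_apply, latticeApprox_comp_two, criticalCorr_two_pair]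
  -- eventually the lattice comparison holds
  set A : ℝ := ‖WithLp.ofLp (x 0) - WithLp.ofLp (x 1)‖ with hA
  set B : ℝ := ‖WithLp.ofLp (x' 0) - WithLp.ofLp (x' 1)‖ with hB
  have hgap : 0 < B - 3 * A := by linarith
  have hev : ∀ᶠ δ in 𝓝[>] (0:ℝ),
      ρ δ ^ 2 * criticalTwoPoint 3 (latticeApprox δ (x' 1) - latticeApprox δ (x' 0)) ≤
        ρ δ ^ 2 * criticalTwoPoint 3 (latticeApprox δ (x 1) - latticeApprox δ (x 0)) := by
    have hm : Set.Ioo (0:ℝ) ((B - 3 * A) / (2 * 3 + 2)) ∈ 𝓝[>] (0:ℝ) := Ioo_mem_nhdsGT (by positivity)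
    filter_upwards [hm] with δ hδ
    refine mul_le_mul_of_nonneg_left ?_ (sq_nonneg _)
    refine twoPointPlus_le_of_mul_supNorm_le hβ ?_
    have h1 := supNorm_latticeApprox_sub_le hδ.1 (x 1) (x 0)
    have h2 := le_supNorm_latticeApprox_sub (d := 3) (by norm_num) hδ.1 (x' 1) (x' 0)
    have hA' : ‖WithLp.ofLp (x 1) - WithLp.ofLp (x 0)‖ = A := by rw [hA, norm_sub_rev]
    have hB' : ‖WithLp.ofLp (x' 1) - WithLp.ofLp (x' 0)‖ = B := by rw [hB, norm_sub_rev]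
    rw [hA'] at h1; rw [hB'] at h2
    have hδlt : δ * (2 * 3 + 2) < B - 3 * A := by
      have := hδ.2; rwa [lt_div_iff₀ (by positivity)] at this
    have key : (3 : ℝ) * (Site.supNorm (latticeApprox δ (x 1) - latticeApprox δ (x 0)) : ℝ) ≤
        (Site.supNorm (latticeApprox δ (x' 1) - latticeApprox δ (x' 0)) : ℝ) := by
      have e1 : (3 : ℝ) * (Site.supNorm (latticeApprox δ (x 1) - latticeApprox δ (x 0)) : ℝ) ≤
          3 * (A / δ + 2) := mul_le_mul_of_nonneg_left h1 (by norm_num)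
      have e2 : (3 : ℝ) * (A / δ + 2) ≤ B / δ - 2 := by
        have hδ0 : δ ≠ 0 := hδ.1.ne'
        have key : (B / δ - 2) - (3 : ℝ) * (A / δ + 2) = (B - 3 * A - δ * (2 * 3 + 2)) / δ := by
          field_simp
          ring
        have hnn : 0 ≤ (B - 3 * A - δ * (2 * 3 + 2)) / δ := div_nonneg (by linarith) hδ.1.le
        linarith [key]
      linarith
    exact_mod_cast key
  exact le_of_tendsto_of_tendsto (hT hx') (hT hx) hev

/-! ### The scale function of a non-degenerate pair limit -/

/-- **The scale identity of a pointwise pair limit.** For a pair limit `S₂ > 0` on non-coincident pairs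
(`ρ > 0` on `(0,1]`) and the reference pair `x₀ = (0, e₀)`, the function
`F(c) := (S₂(c·x₀)/S₂(x₀))^{1/2}` is positive and multiplicative, `S₂(c·x) = F(c)² S₂(x)` for all
`c > 0` and all non-coincident `x`, and `ρ(cδ)/ρ(δ) → F(c)` for `0 < c ≤ 1`. [folklore] -/
theorem pair_scale_identity_pt (hρ : ∀ δ ∈ Set.Ioc (0:ℝ) 1, 0 < ρ δ)
    (hlim2 : ∀ z ∈ NonCoincident 3 2, Tendsto (fun δ => rescaledCorrelator (criticalCorr 3) ρ 2 δ z)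
      (𝓝[>] (0:ℝ)) (𝓝 (S2 z)))
    (hnd2 : ∀ z ∈ NonCoincident 3 2, 0 < S2 z) :
    let x₀ : Fin 2 → EuclideanSpace ℝ (Fin 3) := ![0, EuclideanSpace.single (0 : Fin 3) (1:ℝ)]
    let F : ℝ → ℝ := fun c => Real.sqrt (S2 (fun i => c • x₀ i) / S2 x₀)
    (∀ c, 0 < c → 0 < F c) ∧
    (∀ c, 0 < c → ∀ x ∈ NonCoincident 3 2, S2 (fun i => c • x i) = F c ^ 2 * S2 x) ∧
    (∀ a b, 0 < a → 0 < b → F (a * b) = F a * F b) ∧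
    (∀ c, 0 < c → c ≤ 1 → Tendsto (fun δ => ρ (c * δ) / ρ δ) (𝓝[>] 0) (𝓝 (F c))) := by
  intro x₀ F
  have hx₀ : x₀ ∈ NonCoincident 3 2 := refPair_mem_nonCoincident (d := 3) (by norm_num)
  have ha₀ : 0 < S2 x₀ := hnd2 _ hx₀
  have hFpos : ∀ c, 0 < c → 0 < F c := fun c hc =>
    Real.sqrt_pos.2 (div_pos (hnd2 _ (smul_mem_nonCoincident hc.ne' hx₀)) ha₀)
  have hFsq : ∀ c, 0 < c → F c ^ 2 = S2 (fun i => c • x₀ i) / S2 x₀ := fun c hc =>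
    Real.sq_sqrt (div_pos (hnd2 _ (smul_mem_nonCoincident hc.ne' hx₀)) ha₀).le
  -- the identity (and the ratio limit) for `c ∈ (0,1]` from uniqueness up to scale
  have hsmall : ∀ c, 0 < c → c ≤ 1 → (∀ x ∈ NonCoincident 3 2,
      S2 (fun i => c • x i) = F c ^ 2 * S2 x) ∧
      Tendsto (fun δ => ρ (c * δ) / ρ δ) (𝓝[>] 0) (𝓝 (F c)) := by
    intro c hc hc1
    have hlimc := tendsto_comp_smul_pt hlim2 hc
    have hρc : ∀ δ ∈ Set.Ioc (0:ℝ) 1, 0 < ρ (c * δ) := fun δ hδ =>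
      hρ _ ⟨mul_pos hc hδ.1, mul_le_one₀ hc1 hδ.1.le hδ.2⟩
    have hb0 : 0 < S2 (fun i => c • x₀ i) := hnd2 _ (smul_mem_nonCoincident hc.ne' hx₀)
    obtain ⟨κ, hκ, hscale, hratio⟩ := exists_scale_pt hρ hρc hlim2 hlimc hx₀ ha₀ hb0
    -- `κ = F c`
    have hκF : κ = F c := by
      have h2 : S2 (fun i => c • x₀ i) = κ ^ 2 * S2 x₀ := hscale x₀ hx₀
      have : κ ^ 2 = F c ^ 2 := by rw [hFsq c hc, h2, mul_div_assoc, div_self ha₀.ne', mul_one]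
      have := congrArg Real.sqrt this
      rwa [Real.sqrt_sq hκ.le, Real.sqrt_sq (hFpos c hc).le] at this
    rw [← hκF]
    exact ⟨hscale, hratio⟩
  -- the identity for all `c > 0`
  have hall : ∀ c, 0 < c → ∀ x ∈ NonCoincident 3 2, S2 (fun i => c • x i) = F c ^ 2 * S2 x := by
    intro c hc x hx
    rcases le_or_gt c 1 with hc1 | hc1
    · exact (hsmall c hc hc1).1 x hx
    · have hci : 0 < c⁻¹ := inv_pos.2 hc
      have hci1 : c⁻¹ ≤ 1 := inv_le_one_of_one_le₀ hc1.le
      have hcx : (fun i => c • x i) ∈ NonCoincident 3 2 := smul_mem_nonCoincident hc.ne' hx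
      have key : S2 x = F c⁻¹ ^ 2 * S2 (fun i => c • x i) := by
        have h := (hsmall c⁻¹ hci hci1).1 _ hcx
        simp only [smul_smul, inv_mul_cancel₀ hc.ne', one_smul] at h
        exact h
      have hprod : F c⁻¹ * F c = 1 := by
        have h := (hsmall c⁻¹ hci hci1).1 _ (smul_mem_nonCoincident hc.ne' hx₀)
        simp only [smul_smul, inv_mul_cancel₀ hc.ne', one_smul] at h
        have h2 : S2 (fun i => c • x₀ i) = F c ^ 2 * S2 x₀ := by
          rw [hFsq c hc, div_mul_cancel₀ _ ha₀.ne']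
        rw [h2] at h
        have hsq : (F c⁻¹ * F c) ^ 2 = 1 := by
          have : S2 x₀ * ((F c⁻¹ * F c) ^ 2 - 1) = 0 := by nlinarith [h]
          have := (mul_eq_zero.1 this).resolve_left ha₀.ne'
          linarith
        have hnn : 0 ≤ F c⁻¹ * F c := (mul_pos (hFpos _ hci) (hFpos _ hc)).le
        nlinarith [hsq, hnn]
      have hFci : F c⁻¹ = (F c)⁻¹ := eq_inv_of_mul_eq_one_left hprod
      rw [key, hFci, inv_pow, ← mul_assoc, mul_inv_cancel₀ (pow_ne_zero 2 (hFpos c hc).ne'), one_mul]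
  refine ⟨hFpos, hall, fun a b ha hb => ?_, fun c hc hc1 => (hsmall c hc hc1).2⟩
  -- multiplicativity from the identity at `x₀`
  have h1 : S2 (fun i => (a * b) • x₀ i) = F (a * b) ^ 2 * S2 x₀ := hall _ (mul_pos ha hb) x₀ hx₀
  have h2 : S2 (fun i => (a * b) • x₀ i) = F a ^ 2 * (F b ^ 2 * S2 x₀) := by
    have hb' := hall b hb x₀ hx₀
    have ha' := hall a ha _ (smul_mem_nonCoincident hb.ne' hx₀)
    simp only [smul_smul] at ha'
    rw [ha', hb']
  have hsq : F (a * b) ^ 2 = (F a * F b) ^ 2 := by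
    have : S2 x₀ * (F (a * b) ^ 2 - (F a * F b) ^ 2) = 0 := by nlinarith [h1, h2]
    have := (mul_eq_zero.1 this).resolve_left ha₀.ne'
    linarith
  have := congrArg Real.sqrt hsq
  rwa [Real.sqrt_sq (hFpos _ (mul_pos ha hb)).le,
    Real.sqrt_sq (mul_pos (hFpos a ha) (hFpos b hb)).le] at this

/-- **Scale covariance and regular variation are automatic for a pointwise pair limit.** For a pair scaling
limit `S₂ > 0` (on non-coincident pairs) of the critical `ℤ³` Ising two-point function, with
renormalisation `ρ > 0` on `(0,1]`, there is `Δ ≥ 0` such that `S₂(c·x) = c^{-2Δ} S₂(x)` for every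
`c > 0` and every non-coincident pair `x`, and `ρ(cδ)/ρ(δ) → c^{-Δ}` as `δ → 0⁺` for every `c > 0`.
Mechanism: the scale function `F` of `pair_scale_identity_pt` is multiplicative and `F(c) ≥ 1` for
`c ≤ 1/4` (MMS in the limit, `two_le_two_of_mul_norm_lt_pt`), so `t ↦ log F(e^{-t})` is additive and
monotone, hence linear (`eq_mul_of_monotone_of_map_add_real`). [cite: FrancescoMathieuSenechal1997, §4.3.1] -/
theorem exists_rpow_scale_and_ratio_pt (hρ : ∀ δ ∈ Set.Ioc (0:ℝ) 1, 0 < ρ δ)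
    (hlim2 : ∀ z ∈ NonCoincident 3 2, Tendsto (fun δ => rescaledCorrelator (criticalCorr 3) ρ 2 δ z)
      (𝓝[>] (0:ℝ)) (𝓝 (S2 z)))
    (hnd2 : ∀ z ∈ NonCoincident 3 2, 0 < S2 z) :
    ∃ Δ : ℝ, 0 ≤ Δ ∧
      (∀ c : ℝ, 0 < c → ∀ x ∈ NonCoincident 3 2, S2 (fun i => c • x i) = c ^ (-(2:ℝ) * Δ) * S2 x) ∧
      ∀ c : ℝ, 0 < c → Tendsto (fun δ => ρ (c * δ) / ρ δ) (𝓝[>] 0) (𝓝 (c ^ (-Δ))) := by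
  obtain ⟨hFpos, hall, hmul, hratio⟩ := pair_scale_identity_pt hρ hlim2 hnd2
  set x₀ : Fin 2 → EuclideanSpace ℝ (Fin 3) := ![0, EuclideanSpace.single (0 : Fin 3) (1:ℝ)]
    with hx₀def
  set F : ℝ → ℝ := fun c => Real.sqrt (S2 (fun i => c • x₀ i) / S2 x₀) with hFdef
  have hx₀ : x₀ ∈ NonCoincident 3 2 := refPair_mem_nonCoincident (d := 3) (by norm_num)
  have ha₀ : 0 < S2 x₀ := hnd2 _ hx₀
  -- `F(c) ≥ 1` for `c ≤ 1/4` (MMS inward comparison in the limit)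
  have hFge : ∀ c : ℝ, 0 < c → c * ((3:ℝ) + 1) ≤ 1 → 1 ≤ F c := by
    intro c hc hcd
    have hcx₀ : (fun i => c • x₀ i) ∈ NonCoincident 3 2 := smul_mem_nonCoincident hc.ne' hx₀
    have hfar : (3:ℝ) * ‖WithLp.ofLp (c • x₀ 0) - WithLp.ofLp (c • x₀ 1)‖ <
        ‖WithLp.ofLp (x₀ 0) - WithLp.ofLp (x₀ 1)‖ := by
      rw [norm_ofLp_smul_sub hc.le]
      have hr : 0 < ‖WithLp.ofLp (x₀ 0) - WithLp.ofLp (x₀ 1)‖ := by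
        rw [norm_pos_iff, sub_ne_zero]
        intro h
        have hinj : Function.Injective x₀ := hx₀
        exact absurd (hinj ((WithLp.ofLp_injective 2) h)) (by decide)
      have hdc : (3:ℝ) * c < 1 := by nlinarith
      nlinarith
    have hle : S2 x₀ ≤ S2 (fun i => c • x₀ i) := two_le_two_of_mul_norm_lt_pt hlim2 hcx₀ hx₀ hfar
    rw [hall c hc x₀ hx₀] at hle
    have h1 : 1 ≤ F c ^ 2 := by
      by_contra h
      have h' := not_le.1 h
      nlinarith [ha₀]
    nlinarith [hFpos c hc, h1]
  -- `g t := log F(e^{-t})` is additive and monotone, hence linear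
  set g : ℝ → ℝ := fun t => Real.log (F (Real.exp (-t))) with hgdef
  have hgadd : ∀ s t, g (s + t) = g s + g t := by
    intro s t
    simp only [hgdef, neg_add, Real.exp_add]
    rw [hmul _ _ (Real.exp_pos _) (Real.exp_pos _),
      Real.log_mul (hFpos _ (Real.exp_pos _)).ne' (hFpos _ (Real.exp_pos _)).ne']
  have hg0 : g 0 = 0 := by have := hgadd 0 0; simpa using this
  have hgnat : ∀ (N : ℕ) (u : ℝ), g (N * u) = N * g u := by
    intro N u
    induction N with
    | zero => simp [hg0]
    | succ n ih =>
      have : ((n + 1 : ℕ) : ℝ) * u = n * u + u := by push_cast; ring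
      rw [this, hgadd, ih]; push_cast; ring
  have hgnonneg : ∀ u, 0 ≤ u → 0 ≤ g u := by
    intro u hu
    rcases hu.eq_or_lt with rfl | hu'
    · rw [hg0]
    · obtain ⟨N, hN⟩ := exists_nat_ge (Real.log (3 + 1) / u)
      have hNu : Real.log (3 + 1) ≤ N * u := by rwa [div_le_iff₀ hu'] at hN
      have hN0 : 0 < (N:ℝ) := by
        have hlogpos : 0 < Real.log (3 + 1) := Real.log_pos (by norm_num)
        by_contra h
        have h' := not_lt.1 h
        nlinarith
      have hsmall : Real.exp (-(N * u)) * ((3:ℝ) + 1) ≤ 1 := by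
        rw [Real.exp_neg, inv_mul_le_iff₀ (Real.exp_pos _), mul_one]
        calc (3:ℝ) + 1 = Real.exp (Real.log (3 + 1)) := (Real.exp_log (by norm_num)).symm
          _ ≤ Real.exp (N * u) := Real.exp_le_exp.2 hNu
      have hge : 0 ≤ g (N * u) := Real.log_nonneg (hFge _ (Real.exp_pos _) hsmall)
      rw [hgnat] at hge
      exact le_of_mul_le_mul_left (by simpa using hge) hN0
  have hgmono : Monotone g := by
    intro s t hst
    have : g t = g s + g (t - s) := by rw [← hgadd]; ring_nf
    rw [this]
    linarith [hgnonneg (t - s) (by linarith)]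
  set Δ : ℝ := g 1 with hΔ
  have hglin : ∀ t, g t = t * Δ := eq_mul_of_monotone_of_map_add_real hgmono hgadd
  have hΔ0 : 0 ≤ Δ := by have := hgnonneg 1 zero_le_one; rwa [hglin, one_mul] at this
  -- `F c = c^{-Δ}`
  have hFrpow : ∀ c, 0 < c → F c = c ^ (-Δ) := by
    intro c hc
    have h1 : F c = Real.exp (g (-Real.log c)) := by
      simp only [hgdef, neg_neg, Real.exp_log hc]
      exact (Real.exp_log (hFpos c hc)).symm
    rw [h1, hglin, Real.rpow_def_of_pos hc]
    congr 1
    ring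
  have hcov : ∀ c : ℝ, 0 < c → ∀ x ∈ NonCoincident 3 2,
      S2 (fun i => c • x i) = c ^ (-(2:ℝ) * Δ) * S2 x := by
    intro c hc x hx
    rw [hall c hc x hx, hFrpow c hc]
    congr 1
    rw [show (-(2:ℝ) * Δ) = (-Δ) * 2 by ring, Real.rpow_mul hc.le, Real.rpow_two]
  refine ⟨Δ, hΔ0, hcov, fun c hc => ?_⟩
  -- the ratio: both `ρ(δ)²G` and `ρ(cδ)²G` at `x₀` converge; divide and take square roots
  have h1 : Tendsto (fun δ => ρ δ ^ 2 * criticalCorr 3 2 (fun i => latticeApprox δ (x₀ i))) (𝓝[>] 0)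
      (𝓝 (S2 x₀)) := hlim2 x₀ hx₀
  have h2 : Tendsto (fun δ => ρ (c * δ) ^ 2 * criticalCorr 3 2 (fun i => latticeApprox δ (x₀ i)))
      (𝓝[>] 0) (𝓝 (S2 (fun i => c • x₀ i))) := by
    have h := tendsto_comp_smul_pt hlim2 hc x₀ hx₀
    refine h.congr fun δ => ?_
    rw [rescaledCorrelator_apply]
  have hS : S2 (fun i => c • x₀ i) = c ^ (-(2:ℝ) * Δ) * S2 x₀ := hcov c hc x₀ hx₀
  have hIoc : Set.Ioc (0:ℝ) 1 ∈ 𝓝[>] (0:ℝ) := Ioc_mem_nhdsGT one_pos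
  have hev : ∀ᶠ δ in 𝓝[>] (0:ℝ), δ ∈ Set.Ioc (0:ℝ) 1 ∧ 0 < ρ δ ^ 2 * criticalCorr 3 2
      (fun i => latticeApprox δ (x₀ i)) :=
    (Filter.eventually_of_mem hIoc fun δ hδ => hδ).and (h1.eventually_const_lt ha₀)
  have hratio2 : Tendsto (fun δ => (ρ (c * δ) / ρ δ) ^ 2) (𝓝[>] 0) (𝓝 (c ^ (-(2:ℝ) * Δ))) := by
    have hq := h2.div h1 ha₀.ne'
    rw [hS, mul_div_assoc, div_self ha₀.ne', mul_one] at hq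
    refine hq.congr' ?_
    filter_upwards [hev] with δ hδ
    have hg : criticalCorr 3 2 (fun i => latticeApprox δ (x₀ i)) ≠ 0 := by
      intro h0; rw [h0, mul_zero] at hδ; exact lt_irrefl _ hδ.2
    simp only [Pi.div_apply]
    rw [div_pow, mul_div_mul_right _ _ hg]
  have hcΔ : 0 < c ^ (-Δ) := Real.rpow_pos_of_pos hc _
  have hsq : c ^ (-(2:ℝ) * Δ) = (c ^ (-Δ)) ^ 2 := by
    rw [show (-(2:ℝ) * Δ) = (-Δ) * 2 by ring, Real.rpow_mul hc.le, Real.rpow_two]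
  rw [hsq] at hratio2
  have hsqrt := hratio2.sqrt
  rw [Real.sqrt_sq hcΔ.le] at hsqrt
  refine hsqrt.congr' ?_
  have hIocc : ∀ᶠ δ in 𝓝[>] (0:ℝ), c * δ ∈ Set.Ioc (0:ℝ) 1 := by
    have hm : Set.Ioo (0:ℝ) (1 / c) ∈ 𝓝[>] (0:ℝ) := Ioo_mem_nhdsGT (by positivity)
    filter_upwards [hm] with δ hδ
    refine ⟨mul_pos hc hδ.1, ?_⟩
    have := hδ.2
    rw [lt_div_iff₀ hc] at this
    linarith
  filter_upwards [hev, hIocc] with δ hδ hcδ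
  exact Real.sqrt_sq (div_pos (hρ _ hcδ) (hρ _ hδ.1)).le

end Summit.CriticalPhenomena.Ising3DConformalLimit.HarmonicMomentsIsotropyTwoPoint

end
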